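import Literature.NumberTheory.Rogawski1990.CohDiscreteMemXiFamilyArchPinned      -- ★ `MemXiFamily`, frame of S2♯
import Literature.NumberTheory.Automorphic.TorusCharacterLocalComponents          -- ★ `locTorusIncl`, `torusLocalComponent`
import Literature.NumberTheory.Automorphic.TorusCharacterSplitRigidityCM         -- ★ p849942 `UnitaryGroup.torusCharRigidSplit_cm_forall` (O-RIGID, F0P2-p01 (g18))
import Literature.NumberTheory.Automorphic.UnitaryGroupAdelicOneTorusDictionary   -- ★ `adelicOne_eq_torus`, `adelicOneEquivTorus`, `torusChar`
import Literature.NumberTheory.Automorphic.UnitaryGroupAdelicCenterRational      -- ★ `adelicCenter_mem_range_toAdelic`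
import Literature.NumberTheory.Automorphic.UnitaryGroupDiscreteRepCentralCharacter -- ★ `exists_centralCharacter_adelicCenter` (Z2)
import Literature.NumberTheory.Automorphic.UnitaryGroupHolCotFormsArchCentre      -- ★ `centralCharacter_archCentre_eq_one` (Z4)
import Summits.HodgeConjecture.HodgeConjecture.Theorems.F0P3cRogTripleChiArithmetic -- ★ `rogCentralSum_eq`
import Summits.HodgeConjecture.HodgeConjecture.Theorems.F0P3XiArchDataOfRecord     -- ★ `archTypeOfRecord`
import Summits.HodgeConjecture.HodgeConjecture.Theorems.F0P3cXiCentralCharArchExponent -- ★ p849968 `xiCentralCharArchExponent_forall` (O-ARCH, F0P2-p01 (g18))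
import Summits.HodgeConjecture.HodgeConjecture.Theorems.F0P3cCotangentArchCentreTrivial  -- ★ (B2) `cotangentArchCentreTrivial` (O-ARCHψ, LH1-p01 (g4))
import HarnessLib

/-!
# Crux `H413`, line LH1 «ZENTRUM» — (B0) THE CENTRAL-ι SUB-LEAF OF ORGANS: `a + b + c = 0` for the Rogawski triple of every `ξ` whose family contains a
# (anti)holomorphic cotangent `P`, from ONE remaining organ O-SPLIT (O-RIGID ★ p849942, O-ARCH ★ p849968, O-ARCHψ ★ `F0P3cCotangentArchCentreTrivial` BY NAME)

Cell `hodgecm-mathlib` (D-0151), FLOOR 0, crux item H413 = `stmt-HodgeConjecture-24833` (`--supports`), route of record `HCCMUnconditional`; half A line LH1,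
«ZENTRUM» chapter of LH1-plan (g4) (memo `F0/P3c/LH1/LH1-plan/g4/G5-ZENTRUM-PRICING.v3_1.md`; this file = the plan's sketch v7 OF RECORD `ZentrumCentralIota.sketch.v7.lean`
3221aab208a71b28 with O-ARCHψ consumed by name; (B0) pen LH1-p04 (g3), ruling 06:50:56Z).  Letters are definition-bodied `Prop`s over ★ constants (no instance, no
notation, no `sorry`, no named fact asserted; their docstrings carry locators in prose `[Key, …]` form — a `cite:` tag on a closed `def : Prop` would make the
gate relocate it to `Literature/` as a named fact, which these posited organ texts are not); the head is PROVED.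

TARGET `S2CentralIotaLetter` (= organ CENTRAL-ι of the LH1 leaf preview `StubS2sharp.paydown.skeleton.v4pre.lean` 312bfb508acb1174, verbatim; its frame is the tree
organ GLOBAL-ι^χ's (`Cruxes/H413/Lines/F0_P3c_S2SharpPaydown.lean` ED. 2) minus the token block): `a + b + c = 0` for `(a,b,c) = rogTriple (ξ.pη ι) (ξ.qψ ι)
(tOfArchType k₀ ι)` whenever the ξ-family contains a discrete `P` of (anti)holomorphic cotangent type at the CM frame.
ROAD (no packets, no trace formula, no `(𝔤,K)`-classification): (Z2) ★ `exists_centralCharacter_adelicCenter` gives the central character `ψ_P` on `U(1)(𝔸)`;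
O-ARCHψ (★ `cotangentArchCentreTrivial`): `ψ_P` is trivial on the archimedean centre; O-SPLIT (`XiCentralCharSplitLetter`, the ONE organ left, [M∕L]): at every
SPLIT finite place `ψ_P = η²·ψ_ξ³·μω` on the local torus; O-RIGID (★ `torusCharRigidSplit_cm_forall`): an automorphic continuous character of `T = U(1)_{L∕L⁺}`
trivial at all split places is trivial — applied to `θ = (ψ_P ∘ e⁻¹)·(η²ψ³μ|_T)⁻¹`; hence `η²ψ³μ|_T` is trivial on `T_∞`; O-ARCH (★ `xiCentralCharArchExponent_forall`):
its exponent at `ι`, `3·qψ ι + 2·(pη ι + t_ι) + 1`, vanishes; ★ `rogCentralSum_eq` turns that into `a + b + c = 0`.  Inert places are not used.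
* §1 the five letters (texts = sketch v7 verbatim; O-SPLIT carries the full CENTRAL-ι frame `hdef`, `2 ≤ [L⁺:ℚ]`, `hP`): `S2CentralIotaLetter`, `TorusCharRigidSplitLetter`, `XiCentralCharSplitLetter`, `CotangentArchCentreTrivialLetter`,
  `XiCentralCharArchExponentLetter`;
* §2 `torusCharRigidSplitLetter_holds` (★ p849942), `xiCentralCharArchExponentLetter_holds` (★ p849968), `cotangentArchCentreTrivialLetter_holds` (★ (B2)) — each
  by `exact` of the ★ theorem (same-statement ties `tie/TieORigid…`, `tie/TieOArch…`, `TieB2…` of the plan, `rfl`);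
* §3 HEAD `s2CentralIota_of_organs : XiCentralCharSplitLetter → S2CentralIotaLetter`, PROVED.
HONEST LABEL: HC_CM is proved only modulo the 7 printed citations (2 remaining: hLiu418 = stmt-HodgeConjecture-24832, h413 = stmt-HodgeConjecture-24833) until
rung 0 closes; count-neutral until the LH1 leaf is re-written with CENTRAL-ι ★ (then GLOBAL-ι^χ ↦ the strictly smaller CASIMIR-ι).

References: [Rogawski1990] J. Rogawski, *Automorphic representations of unitary groups in three variables* (1990), Lemma 4.13.1 (b) p. 64, §12.1 p. 172,
§12.3 pp. 174–178, §13.3 p. 201; [PlatonovRapinchuk1994] §6.2, §7.3; [CasselsFrohlichANT1967] Ch. II §15; [Liu2021] proof of Prop. 4.13 Case 1 (l. 2137);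
[BorelJacquet1979] §4.6; [Arthur2011Draft] d-p.319 (§6.2 Remark 2).
-/

set_option autoImplicit false
-- the mandated namespace has the single-problem summit's repeated segment (`HodgeConjecture.HodgeConjecture`)
set_option linter.dupNamespace false

noncomputable section

open NumberField IsDedekindDomain MeasureTheory
open scoped Matrix ComplexOrder

namespace Summit.HodgeConjecture.HodgeConjecture.Cruxes.H413.F0P3cXiCentralIotaOfOrgans

open Literature.NumberTheory.Automorphic Literature.NumberTheory.Automorphic.UnitaryGroup
open Literature.NumberTheory.Automorphic.UnitaryGroup.CotangentForms
open Literature.NumberTheory.Automorphic.Arthur2013.Leaves.TECR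
open Literature.NumberTheory.GaloisRepresentations
open Literature.NumberTheory.Rogawski1990
open Summit.HodgeConjecture.HodgeConjecture.Cruxes.H413.F0P3XiArchDataOfRecord
open Summit.HodgeConjecture.HodgeConjecture.Cruxes.H413.F0P3cRogTripleChiArithmetic

/-- **TARGET — ORGAN CENTRAL-ι** (verbatim copy of `S2CentralIotaLetter` of the LH1 leaf preview v4pre 312bfb508acb1174; frame = tree organ GLOBAL-ι^χ's minus the
token block): the CENTRAL EXPONENT `a + b + c` of Rogawski's triple vanishes for every `ξ` whose family contains a cotangent `P`. [Rogawski1990, §12.3 pp. 174–178 (Prop. 12.3.3); Thm. 13.3.5 (p. 202); §14.6 Thm. 14.6.4 (p. 243)] -/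
def S2CentralIotaLetter : Prop :=
  ∀ (L : Type) [Field L] [NumberField L] [IsCMField L] (ι : L →+* ℂ) (H : Matrix (Fin 3) (Fin 3) L) (T : GL (Fin 3) ℂ)
    (hT : (T : Matrix (Fin 3) (Fin 3) ℂ)ᴴ * H.map ι * (T : Matrix (Fin 3) (Fin 3) ℂ) = Literature.Geometry.ComplexHyperbolic.BallModel.J),
    (∀ τ' : L →+* ℂ, InfinitePlace.mk τ' ≠ InfinitePlace.mk ι → (H.map τ').PosDef) →
    2 ≤ Module.finrank ℚ ↥(maximalRealSubfield L) →
    ∀ (μ : Measure (adelicGroupData (↥(maximalRealSubfield L)) L (IsCMField.complexConj L) 3 H).automorphicQuotient)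
      [(adelicGroupData (↥(maximalRealSubfield L)) L (IsCMField.complexConj L) 3 H).IsAutomorphicMeasure μ]
      (μω : HeckeCharacter L) (hμu : μω.IsUnitary),
      (∀ x : Literature.NumberTheory.GaloisRepresentations.ideleGroup ↥(maximalRealSubfield L),
        μω (AdeleRing.ideleBaseChange (↥(maximalRealSubfield L)) L x) = quadraticHeckeCharCM L x) →
    ∀ (P : DiscreteAutomorphicRep (adelicGroupData (↥(maximalRealSubfield L)) L (IsCMField.complexConj L) 3 H) μ),
      (P.IsHolCotangentAt (cmArchSection L ι H T hT) (cmCompactFactor L ι H T hT) ∨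
        P.IsAntiholCotangentAt (cmArchSection L ι H T hT) (cmCompactFactor L ι H T hT)) →
        ∀ ξ : OneDimAutRepH L,
          MemXiFamily P (transpose_map_cmConjRingHom_eq_of_frame L ι H T hT) (isUnit_det_of_frame L ι H T hT) μω hμu ξ →
            ∀ a b c : ℤ, ArchSignRecipe.rogTriple (ξ.pη ι) (ξ.qψ ι) (ArchSignRecipe.tOfArchType (archTypeOfRecord μω) ι) = (a, b, c) →
              a + b + c = 0

/-- ORGAN O-RIGID «T-RIGID» [M; number theory, P-free]: an automorphic continuous character of the adèlic norm-one torus `T(𝔸_{L⁺}) = U(1)_{L∕L⁺}(𝔸)`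
whose local component is trivial at EVERY place of `L⁺` split in `L` is trivial.  Road: `θ` factors through `T(𝔸)∕∏'_{v split} T_v ≅ ∏_{v non-split} T(L⁺_v) × T_∞`
(a product of COMPACT groups, product topology since `T(L⁺_v) = T(𝒪_v)` at unramified inert `v`, ★ `locTorusIncl_mem_localUnitIdeles_of_smul_eq`), on which
`T(L⁺)` is dense (density in a product topology = density in every finite sub-product = WEAK APPROXIMATION for `T` at finitely many places, from Artin–Whaples for `L`
and Hilbert 90 `T = {ȳ∕y}` locally and globally).  No L-functions.  WHY IT MIGHT FAIL AS TYPED: none known (the archimedean components are NOT assumed trivial — they need not be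
hypothesised: `T_∞` is one of the compact factors). [PlatonovRapinchuk1994, §7.3 (weak approximation), §6.2] [CasselsFrohlichANT1967, Ch. II §15 (approximation theorem)] -/
def TorusCharRigidSplitLetter : Prop :=
  ∀ (L : Type) [Field L] [NumberField L] [IsCMField L]
    (θ : ↥(TorusDict.torus (IsCMField.complexConj L)) →* ℂˣ),
    Continuous (fun t => ((θ t : ℂˣ) : ℂ)) →
    (∀ t : ↥(TorusDict.torus (IsCMField.complexConj L)), (t : ideleGroup L) ∈ principalIdeles L → θ t = 1) →
    (∀ v : HeightOneSpectrum (𝓞 ↥(maximalRealSubfield L)),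
        (∃ w : PlacesOver L v, IsCMField.complexConj L • w.1 ≠ w.1) →
        ∀ t : ↥(normOneUnits (conjLocal L (IsCMField.complexConj L) v)), θ (locTorusIncl L (IsCMField.complexConj L) v t) = 1) →
    θ = 1

/-- ORGAN O-SPLIT «ZENTRUM-SPLIT» [M∕L; the only organ that opens `P` at finite places; v7: the FULL CENTRAL-ι frame incl. `hdef`, `2 ≤ [L⁺:ℚ]` and the cotangent clause `hP`,
so that a constituent at `v` EXISTS cheaply — ★ `cohForms_le_smoothFun`∕`smoothFun_eq_smoothPart` make the class of the cotangent form a NON-ZERO SMOOTH VECTOR, then ★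
`exists_isConstituentOf_of_smoothPart_ne_bot`; without `hP` the payer would owe «smooth vectors ≠ 0 in every discrete automorphic `P`» (Haar averaging, not in tree)]:
for cotangent `P` in the ξ-family and ANY character `ψ` through which the adèlic centre
acts on `P` (★ `exists_centralCharacter_adelicCenter`), at every SPLIT `v` and every local torus element `t ∈ T(L⁺_v)`: `ψ(t) = η(t)² · ψ_ξ(t)³ · μ(t)`.
Road: (Z2b) the local centre `t·1₃ ∈ U(H)(L⁺_v)` is `adelicCenter` of the idèle `locTorusIncl t` (★ `finAdelicEquiv_inclPlace`, ★ `coe_adelicCenter`); (Z2c) so `P.finRep ∘ inclPlace v` has central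
character `ψ ∘ locTorusIncl`; a local constituent exists (non-zero smooth vectors + an irreducible subquotient) and inherits it (★ p849599 `IsConstituentOf.hasCentralCharacter_comp`);
by `MemXiFamily` it is THE split member (★ `IsXiLocalFamily.eq_cmSplitPacket`) `Ind((ν₀∘det) ⊠ ψ_w)`, `ν₀ = η_w ψ_w μ_w` (★ `splitν₀`), whose central character on `a·1₃` is
`ν₀(a)² ψ_w(a) = η_w(a)² ψ_w(a)³ μ_w(a)²` = `η(t)² ψ(t)³ μ(t)` for `t ↔ a` (★ `cm_pullback_semilocalComponent`, `μ_{w̄}(ā)⁻¹ = μ_w(a)` at split `v` since `ω_v = 1`).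
WHY IT MIGHT FAIL AS TYPED: an exponent∕sign slip in the dictionary `t ↔ a` (`locη = (bcη_w)⁻¹`) — R-cal, first census item. [Rogawski1990, Lemma 4.13.1 (b) p. 64; §13.3 p. 201; §12.1 p. 172]
[BorelJacquet1979, §4.6] -/
def XiCentralCharSplitLetter : Prop :=
  ∀ (L : Type) [Field L] [NumberField L] [IsCMField L] (ι : L →+* ℂ) (H : Matrix (Fin 3) (Fin 3) L) (T : GL (Fin 3) ℂ)
    (hT : (T : Matrix (Fin 3) (Fin 3) ℂ)ᴴ * H.map ι * (T : Matrix (Fin 3) (Fin 3) ℂ) = Literature.Geometry.ComplexHyperbolic.BallModel.J),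
    (∀ τ' : L →+* ℂ, InfinitePlace.mk τ' ≠ InfinitePlace.mk ι → (H.map τ').PosDef) →
    2 ≤ Module.finrank ℚ ↥(maximalRealSubfield L) →
    ∀ (μ : Measure (adelicGroupData (↥(maximalRealSubfield L)) L (IsCMField.complexConj L) 3 H).automorphicQuotient)
      [(adelicGroupData (↥(maximalRealSubfield L)) L (IsCMField.complexConj L) 3 H).IsAutomorphicMeasure μ]
      (μω : HeckeCharacter L) (hμu : μω.IsUnitary),
      (∀ x : Literature.NumberTheory.GaloisRepresentations.ideleGroup ↥(maximalRealSubfield L),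
        μω (AdeleRing.ideleBaseChange (↥(maximalRealSubfield L)) L x) = quadraticHeckeCharCM L x) →
    ∀ (P : DiscreteAutomorphicRep (adelicGroupData (↥(maximalRealSubfield L)) L (IsCMField.complexConj L) 3 H) μ),
      (P.IsHolCotangentAt (cmArchSection L ι H T hT) (cmCompactFactor L ι H T hT) ∨
        P.IsAntiholCotangentAt (cmArchSection L ι H T hT) (cmCompactFactor L ι H T hT)) →
      ∀ (ψ : ↥(adelicOne (↥(maximalRealSubfield L)) L (IsCMField.complexConj L)) →* ℂˣ),
      (∀ (u : ↥(adelicOne (↥(maximalRealSubfield L)) L (IsCMField.complexConj L))) (f : P.space.toSubmodule),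
        P.space.toContRep (adelicCenter (↥(maximalRealSubfield L)) L (IsCMField.complexConj L) 3 H u) f = ((ψ u : ℂˣ) : ℂ) • f) →
      ∀ ξ : OneDimAutRepH L,
        MemXiFamily P (transpose_map_cmConjRingHom_eq_of_frame L ι H T hT) (isUnit_det_of_frame L ι H T hT) μω hμu ξ →
        ∀ (v : HeightOneSpectrum (𝓞 ↥(maximalRealSubfield L))),
          (∃ w : PlacesOver L v, IsCMField.complexConj L • w.1 ≠ w.1) →
          ∀ t : ↥(normOneUnits (conjLocal L (IsCMField.complexConj L) v)),
            ψ ((adelicOneEquivTorus (↥(maximalRealSubfield L)) L (IsCMField.complexConj L)).symm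
                (locTorusIncl L (IsCMField.complexConj L) v t)) =
              ξ.η (locTorusIncl L (IsCMField.complexConj L) v t) ^ 2 * ξ.ψ (locTorusIncl L (IsCMField.complexConj L) v t) ^ 3 *
                μω ((locTorusIncl L (IsCMField.complexConj L) v t : ↥(TorusDict.torus (IsCMField.complexConj L))) : ideleGroup L)

/-- ORGAN O-ARCHψ «χ_∞ = 1 for cotangent P» [S∕M]: the centre acts trivially at infinity on a hol∕antihol cotangent `P` — ★ `centralCharacter_archCentre_eq_one` (Z4) plus
(i) a non-zero `L²`-class of a coordinate of the non-zero cotangent form supplied by `IsHolCotangentAt` (continuity of the form + positivity of the automorphic `μ` on open sets — the crux pin's ★ `exists_toLp_ne_zero` ∕ `toLp_toQuotFun_ne_zero_of_mem_cohForms` pattern, whence the frame's `hdef`∕`2 ≤ [L⁺:ℚ]` binders), (ii) the antiholomorphic twin of Z4.  WHY IT MIGHT FAIL AS TYPED: (i) for an abstract automorphic measure `μ` the class of a non-zero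
continuous form could vanish — if so, the organ needs the frame's positivity clause (check `IsHolCotangentAt`'s definition first). [Liu2021, proof of Prop. 4.13 Case 1 (l. 2137)]
[BorelJacquet1979, §4.6] -/
def CotangentArchCentreTrivialLetter : Prop :=
  ∀ (L : Type) [Field L] [NumberField L] [IsCMField L] (ι : L →+* ℂ) (H : Matrix (Fin 3) (Fin 3) L) (T : GL (Fin 3) ℂ)
    (hT : (T : Matrix (Fin 3) (Fin 3) ℂ)ᴴ * H.map ι * (T : Matrix (Fin 3) (Fin 3) ℂ) = Literature.Geometry.ComplexHyperbolic.BallModel.J),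
    (∀ τ' : L →+* ℂ, InfinitePlace.mk τ' ≠ InfinitePlace.mk ι → (H.map τ').PosDef) →
    2 ≤ Module.finrank ℚ ↥(maximalRealSubfield L) →
    ∀ (μ : Measure (adelicGroupData (↥(maximalRealSubfield L)) L (IsCMField.complexConj L) 3 H).automorphicQuotient)
      [(adelicGroupData (↥(maximalRealSubfield L)) L (IsCMField.complexConj L) 3 H).IsAutomorphicMeasure μ]
      (P : DiscreteAutomorphicRep (adelicGroupData (↥(maximalRealSubfield L)) L (IsCMField.complexConj L) 3 H) μ),
      (P.IsHolCotangentAt (cmArchSection L ι H T hT) (cmCompactFactor L ι H T hT) ∨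
        P.IsAntiholCotangentAt (cmArchSection L ι H T hT) (cmCompactFactor L ι H T hT)) →
      ∀ (ψ : ↥(adelicOne (↥(maximalRealSubfield L)) L (IsCMField.complexConj L)) →* ℂˣ),
        (∀ (u : ↥(adelicOne (↥(maximalRealSubfield L)) L (IsCMField.complexConj L))) (f : P.space.toSubmodule),
          P.space.toContRep (adelicCenter (↥(maximalRealSubfield L)) L (IsCMField.complexConj L) 3 H u) f = ((ψ u : ℂˣ) : ℂ) • f) →
        ∀ y : ↥(relNormOneInfUnits (↥(maximalRealSubfield L)) L), ψ ((cmAdelicOneEquivRelNormOne L).symm (relNormOneInfToIdeles (↥(maximalRealSubfield L)) L y)) = 1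

/-- ORGAN O-ARCH «archimedean exponent of `η²ψ³μ|_T` at `ι`» [S∕M; pure bookkeeping, `P`-free]: if the character `t ↦ η(t)² ψ(t)³ μ(t)` of `T(𝔸)` is trivial on the
archimedean torus `T_∞ = U(1)(L⁺ ⊗ ℝ)` (elements `(y, 1)`, ★ `cmArchUnitHom` read in the torus currency), then its exponent at `ι` vanishes:
`3·qψ ι + 2·(pη ι + t_ι) + 1 = 0`, `t_ι = tOfArchType (archTypeOfRecord μ) ι`.  Road: ★ `η_arch_apply` ∕ `ψ_arch_apply` (types `−eη`, `−eψ`), the archimedean type of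
record of `μ` (★ `archTypeOfRecord_eq`: `μ_ι(z) = (z∕z̄)^{t+1∕2}`), ★ `expAt` bookkeeping `{ι, ῑ}`, and «a character of `∏_w U(1)` with exponent vector `E` is trivial ⇒ `E = 0`»
(★ `relNormOneInfUnitsEquivCircles`).  WHY IT MIGHT FAIL AS TYPED: a sign convention between `expAt` (`η_ι(u) = u^p`) and `archWeight`; the identity is invariant under
`(p,q,t) ↦ (−p,−q,−t−1)`, so only a GLOBAL sign slip would break it — R-cal. [Rogawski1990, §12.3 pp. 174, 178] [Arthur2011Draft, d-p.319 (§6.2 Remark 2)] -/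
def XiCentralCharArchExponentLetter : Prop :=
  ∀ (L : Type) [Field L] [NumberField L] [IsCMField L] (ι : L →+* ℂ) (ξ : OneDimAutRepH L)
    (μω : HeckeCharacter L), μω.IsUnitary →
    (∀ x : Literature.NumberTheory.GaloisRepresentations.ideleGroup ↥(maximalRealSubfield L),
        μω (AdeleRing.ideleBaseChange (↥(maximalRealSubfield L)) L x) = quadraticHeckeCharCM L x) →
    (∀ y : ↥(relNormOneInfUnits (↥(maximalRealSubfield L)) L),
        ξ.η (adelicOneEquivTorus (↥(maximalRealSubfield L)) L (IsCMField.complexConj L) ((cmAdelicOneEquivRelNormOne L).symm (relNormOneInfToIdeles (↥(maximalRealSubfield L)) L y))) ^ 2 *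
          ξ.ψ (adelicOneEquivTorus (↥(maximalRealSubfield L)) L (IsCMField.complexConj L) ((cmAdelicOneEquivRelNormOne L).symm (relNormOneInfToIdeles (↥(maximalRealSubfield L)) L y))) ^ 3 *
          μω (((cmAdelicOneEquivRelNormOne L).symm (relNormOneInfToIdeles (↥(maximalRealSubfield L)) L y) : ↥(adelicOne (↥(maximalRealSubfield L)) L (IsCMField.complexConj L))) : ideleGroup L) = 1) →
    3 * ξ.qψ ι + 2 * (ξ.pη ι + ArchSignRecipe.tOfArchType (archTypeOfRecord μω) ι) + 1 = 0

/-- O-RIGID is ★: the letter `TorusCharRigidSplitLetter` IS the statement of ★ p849942 `UnitaryGroup.torusCharRigidSplit_cm_forall` (same-statement tie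
`tie/TieORigid.statement.LH1plang4.lean` c2bedbde9231ce6e, `rfl`). [cite: PlatonovRapinchuk1994, §7.3] [cite: CasselsFrohlichANT1967, Ch. II §15] -/
theorem torusCharRigidSplitLetter_holds : TorusCharRigidSplitLetter :=
  UnitaryGroup.torusCharRigidSplit_cm_forall

/-- O-ARCH is ★: the letter `XiCentralCharArchExponentLetter` IS the statement of ★ p849968 `xiCentralCharArchExponent_forall` (same-statement tie
`tie/TieOArch.statement.LH1plang4.lean` ffb894fca2119dfc, `rfl`). [cite: Rogawski1990, §12.3 pp. 174, 178] [cite: Arthur2011Draft, d-p.319 (§6.2 Remark 2)] -/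
theorem xiCentralCharArchExponentLetter_holds : XiCentralCharArchExponentLetter :=
  F0P3cXiCentralCharArchExponent.xiCentralCharArchExponent_forall

/-- O-ARCHψ is ★: the letter `CotangentArchCentreTrivialLetter` IS the statement of ★ (B2) `F0P3cCotangentArchCentreTrivial.cotangentArchCentreTrivial` (LH1-p01 (g4);
same-statement tie `TieB2.letter.LH1p01g4.lean` 17d10f4be37ee199). [cite: Liu2021, proof of Prop. 4.13 Case 1, l. 2137] [cite: BorelJacquet1979, §4.6] -/
theorem cotangentArchCentreTrivialLetter_holds : CotangentArchCentreTrivialLetter :=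
  F0P3cCotangentArchCentreTrivial.cotangentArchCentreTrivial

/-- **HEAD (assembly, PROVED): the ONE organ O-SPLIT ⇒ CENTRAL-ι**, with O-RIGID (★ p849942), O-ARCH (★ p849968) and O-ARCHψ (★ `cotangentArchCentreTrivial`) by name.
Z2 gives `ψ`; O-ARCHψ gives `ψ|_{T_∞} = 1`; O-SPLIT + O-RIGID (applied to `θ = torusChar ψ · (η²ψ³μ|_T)⁻¹`, automorphic by Z2's rationality clause, `ξ.hη`, `ξ.hψ` and
`μω.map_principal`) give `ψ = η²ψ³μ|_T` on `T(𝔸)`; hence `η²ψ³μ|_T` is trivial on `T_∞`; O-ARCH gives the exponent identity; ★ `rogCentralSum_eq` turns it into `a+b+c = 0`. [cite: Rogawski1990, §12.3 pp. 174–178; §13.3 p. 201] [cite: PlatonovRapinchuk1994, §7.3] -/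
theorem s2CentralIota_of_organs (hS : XiCentralCharSplitLetter) : S2CentralIotaLetter := by
  have hA : CotangentArchCentreTrivialLetter := cotangentArchCentreTrivialLetter_holds
  have hR : TorusCharRigidSplitLetter := torusCharRigidSplitLetter_holds
  have hE : XiCentralCharArchExponentLetter := xiCentralCharArchExponentLetter_holds
  intro L _ _ _ ι H T hT hdef h2 μ _ μω hμu hμω P hP ξ hmem a b c habc
  classical
  -- (Z2) the central character of `P`
  obtain ⟨ψ, -, hψc, hψ1, hψ⟩ := DiscreteAutomorphicRep.exists_centralCharacter_adelicCenter P
  -- (O-ARCHψ) `ψ` is trivial on the archimedean centre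
  have harch := hA L ι H T hT hdef h2 μ P hP ψ hψ
  -- (O-SPLIT) `ψ = η²ψ³μ` on the local torus at every split place
  have hsplit := hS L ι H T hT hdef h2 μ μω hμu hμω P hP ψ hψ ξ hmem
  -- the comparison character `θ = (ψ ∘ (T ≃ U(1))) · (η²ψ³μ|_T)⁻¹` on `T(𝔸)`
  set e := adelicOneEquivTorus (↥(maximalRealSubfield L)) L (IsCMField.complexConj L) with he
  let cξ : ↥(TorusDict.torus (IsCMField.complexConj L)) → ℂˣ := fun t =>
    ξ.η t ^ 2 * ξ.ψ t ^ 3 * μω ((t : ↥(TorusDict.torus (IsCMField.complexConj L))) : ideleGroup L)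
  have cξ_mul : ∀ s t, cξ (s * t) = cξ s * cξ t := by
    intro s t
    simp only [cξ, map_mul, Subgroup.coe_mul]
    apply Units.ext
    simp only [Units.val_mul, Units.val_pow_eq_pow_val]
    ring
  let θ : ↥(TorusDict.torus (IsCMField.complexConj L)) →* ℂˣ :=
    { toFun := fun t => ψ (e.symm t) * (cξ t)⁻¹
      map_one' := by simp only [cξ, map_one, Subgroup.coe_one, one_pow, one_mul, inv_one]
      map_mul' := by
        intro s t
        rw [map_mul, map_mul, cξ_mul]
        apply Units.ext
        simp only [Units.val_mul, Units.val_inv_eq_inv_val]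
        ring }
  have hθ_apply : ∀ t, θ t = ψ (e.symm t) * (cξ t)⁻¹ := fun t => rfl
  -- continuity of `θ`
  have hθc : Continuous (fun t => ((θ t : ℂˣ) : ℂ)) := by
    have hc1 : Continuous fun t : ↥(TorusDict.torus (IsCMField.complexConj L)) => ((ψ (e.symm t) : ℂˣ) : ℂ) :=
      hψc.comp (continuous_adelicOneEquivTorus_symm (↥(maximalRealSubfield L)) L (IsCMField.complexConj L))
    have hc2 : Continuous fun t : ↥(TorusDict.torus (IsCMField.complexConj L)) => ((cξ t : ℂˣ) : ℂ) := by
      have hη : Continuous fun t : ↥(TorusDict.torus (IsCMField.complexConj L)) => ((ξ.η t : ℂˣ) : ℂ) :=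
        Units.continuous_val.comp (map_continuous ξ.η)
      have hψ' : Continuous fun t : ↥(TorusDict.torus (IsCMField.complexConj L)) => ((ξ.ψ t : ℂˣ) : ℂ) :=
        Units.continuous_val.comp (map_continuous ξ.ψ)
      have hμ : Continuous fun t : ↥(TorusDict.torus (IsCMField.complexConj L)) =>
          ((μω ((t : ↥(TorusDict.torus (IsCMField.complexConj L))) : ideleGroup L) : ℂˣ) : ℂ) :=
        Units.continuous_val.comp ((map_continuous μω).comp continuous_subtype_val)
      have : (fun t : ↥(TorusDict.torus (IsCMField.complexConj L)) => ((cξ t : ℂˣ) : ℂ)) =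
          fun t => ((ξ.η t : ℂˣ) : ℂ) ^ 2 * ((ξ.ψ t : ℂˣ) : ℂ) ^ 3 *
            ((μω ((t : ↥(TorusDict.torus (IsCMField.complexConj L))) : ideleGroup L) : ℂˣ) : ℂ) := by
        funext t; simp only [cξ, Units.val_mul, Units.val_pow_eq_pow_val]
      rw [this]
      exact ((hη.pow 2).mul (hψ'.pow 3)).mul hμ
    have : (fun t => ((θ t : ℂˣ) : ℂ)) = fun t => ((ψ (e.symm t) : ℂˣ) : ℂ) * (((cξ t : ℂˣ) : ℂ))⁻¹ := by
      funext t; rw [hθ_apply, Units.val_mul, Units.val_inv_eq_inv_val]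
    rw [this]
    exact hc1.mul (hc2.inv₀ fun t => (cξ t).ne_zero)
  -- automorphy of `θ`
  have hθaut : ∀ t : ↥(TorusDict.torus (IsCMField.complexConj L)), (t : ideleGroup L) ∈ principalIdeles L → θ t = 1 := by
    intro t ht
    have h1 : ψ (e.symm t) = 1 :=
      hψ1 _ (adelicCenter_mem_range_toAdelic (↥(maximalRealSubfield L)) L (IsCMField.complexConj L) 3 H (e.symm t)
        (by rw [he, coe_adelicOneEquivTorus_symm]; exact ht))
    have h2' : cξ t = 1 := by
      simp only [cξ, ξ.hη t ht, ξ.hψ t ht, μω.map_principal ht, one_pow, one_mul]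
    rw [hθ_apply, h1, h2', inv_one, one_mul]
  -- triviality of `θ` at split places
  have hθsplit : ∀ v : HeightOneSpectrum (𝓞 ↥(maximalRealSubfield L)),
      (∃ w : PlacesOver L v, IsCMField.complexConj L • w.1 ≠ w.1) →
      ∀ t : ↥(normOneUnits (conjLocal L (IsCMField.complexConj L) v)), θ (locTorusIncl L (IsCMField.complexConj L) v t) = 1 := by
    intro v hs t
    rw [hθ_apply, hsplit v hs t]
    exact mul_inv_cancel _
  -- (O-RIGID) `θ = 1`, i.e. `ψ = η²ψ³μ` on all of `T(𝔸)`; read it on the archimedean torus with (O-ARCHψ)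
  have hθ1 : θ = 1 := hR L θ hθc hθaut hθsplit
  have harch' : ∀ y : ↥(relNormOneInfUnits (↥(maximalRealSubfield L)) L),
      ξ.η (e ((cmAdelicOneEquivRelNormOne L).symm (relNormOneInfToIdeles (↥(maximalRealSubfield L)) L y))) ^ 2 *
        ξ.ψ (e ((cmAdelicOneEquivRelNormOne L).symm (relNormOneInfToIdeles (↥(maximalRealSubfield L)) L y))) ^ 3 *
        μω (((cmAdelicOneEquivRelNormOne L).symm (relNormOneInfToIdeles (↥(maximalRealSubfield L)) L y) :
          ↥(adelicOne (↥(maximalRealSubfield L)) L (IsCMField.complexConj L))) : ideleGroup L) = 1 := by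
    intro y
    set u := (cmAdelicOneEquivRelNormOne L).symm (relNormOneInfToIdeles (↥(maximalRealSubfield L)) L y) with hu
    have h := DFunLike.congr_fun hθ1 (e u)
    rw [hθ_apply, MonoidHom.one_apply, MulEquiv.symm_apply_apply, harch y, one_mul, inv_eq_one] at h
    simpa only [cξ, he, coe_adelicOneEquivTorus] using h
  -- (O-ARCH) the exponent at `ι` vanishes; ★ `rogCentralSum_eq` converts it into `a + b + c = 0`
  have hexp := hE L ι ξ μω hμu hμω harch'
  have hsum := rogCentralSum_eq (ξ.pη ι) (ξ.qψ ι) (ArchSignRecipe.tOfArchType (archTypeOfRecord μω) ι)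
  unfold rogCentralSum at hsum
  rw [habc] at hsum
  simp only at hsum
  omega

end Summit.HodgeConjecture.HodgeConjecture.Cruxes.H413.F0P3cXiCentralIotaOfOrgans

end
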